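import Summits.NavierStokesRegularity.NavierStokesRegularity.Theses.AxisymmetricExtremality
import Summits.NavierStokesRegularity.NavierStokesRegularity.Theorems.AxisymmetricExtremalityPFoldToAxisymmetric
import Summits.NavierStokesRegularity.NavierStokesRegularity.Theorems.AxisymmetricExtremalityAxisymmetricKatoGlobalNoSwirlStratum
import HarnessLib

/-!
# Strategist census s20-g14 (family `s`, INDEPENDENT) — crux `AxisymmetricKatoGlobal` (stmt-NavierStokesRegularity-15453)

Kernel-checked companion of `Cruxes/AxisymmetricKatoGlobal/STRATEGY-CENSUS-s20.md`.
Nothing here proves the crux.  It records, sorry-free: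

* `NoAxisymMinimalDatum` (W0) — the strictly weaker intermediate that the route's deciding theorem
  `closes` actually consumes from the crux ("no Rusin–Šverák minimal blow-up datum is axisymmetric"),
  with `noAxisymMinimalDatum_of_axisymmetricKatoGlobal : AKG → W0` and the re-glue
  `navierStokesRegularity_of_noAxisymMinimalDatum : MinimalDatumPFold → W0 → NavierStokesRegularity`
  (using the PROVED `PFoldToAxisymmetric`);
* `NoAxisymSwirlMinimalDatum` (W2: an axisymmetric minimal datum is swirl-free) and
  `noAxisymMinimalDatum_iff_noAxisymSwirlMinimalDatum : W0 ↔ W2` over the landed swirl-free stratum;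
* `minimalDatumPFold_iff_summit_of_W0 : W0 → (MinimalDatumPFold ↔ NavierStokesRegularity)` —
  relative to W0 the other open crux is already summit-equivalent, so W0 (hence AKG) carries the
  whole PDE content of the route.
-/

set_option linter.dupNamespace false

noncomputable section

open MeasureTheory Set Function
open Literature.Analysis.FluidPDE
open Summit.NavierStokesRegularity.NavierStokesRegularity.Theses.AxisymmetricExtremality

namespace Summit.NavierStokesRegularity.NavierStokesRegularity.Cruxes.AxisymmetricKatoGlobal.StrategistS20g14

local notation "ℝ³" => EuclideanSpace ℝ (Fin 3)
local notation "ℂ³" => EuclideanSpace ℂ (Fin 3)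

/-- The crux's written-out rotation clause is `IsAxisymmetric` (definitional). -/
theorem isAxisymmetric_iff_written (u₀ : ℝ³ → ℝ³) :
    IsAxisymmetric u₀ ↔
      (∀ (θ : ℝ) (x : ℝ³), u₀ (WithLp.toLp 2 ![Real.cos θ * x 0 - Real.sin θ * x 1,
          Real.sin θ * x 0 + Real.cos θ * x 1, x 2]) =
        WithLp.toLp 2 ![Real.cos θ * u₀ x 0 - Real.sin θ * u₀ x 1,
          Real.sin θ * u₀ x 0 + Real.cos θ * u₀ x 1, u₀ x 2]) :=
  ⟨fun h θ x => h θ x, fun h θ x => h θ x⟩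

/-- **W0** — no axisymmetric minimal blow-up datum: for every `ν > 0`, no member `(u₀, g)` of
Rusin–Šverák's set `M(ν)` of `Ḣ^{1/2}`-norm-minimal singularity-generating data is axisymmetric.
Equivalently: the axisymmetric blow-up threshold `ρ_ax(ν)` is not ATTAINED at `ρ_max^pure(ν)`. -/
def NoAxisymMinimalDatum : Prop :=
  ∀ ν : ℝ, 0 < ν → ∀ (u₀ : ℝ³ → ℝ³) (g : Literature.Analysis.FunctionSpaces.HomSobolev ℝ³ ℂ³ (1 / 2 : ℝ)),
    IsMinimalBlowupDatum ν u₀ g → ¬ IsAxisymmetric u₀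

/-- **W2** — an axisymmetric minimal blow-up datum is swirl-free. -/
def NoAxisymSwirlMinimalDatum : Prop :=
  ∀ ν : ℝ, 0 < ν → ∀ (u₀ : ℝ³ → ℝ³) (g : Literature.Analysis.FunctionSpaces.HomSobolev ℝ³ ℂ³ (1 / 2 : ℝ)),
    IsMinimalBlowupDatum ν u₀ g → IsAxisymmetric u₀ → HasNoSwirl u₀

/-- AKG ⇒ W0 (the only instance of the crux that `closes` consumes). -/
theorem noAxisymMinimalDatum_of_axisymmetricKatoGlobal (h : AxisymmetricKatoGlobal) :
    NoAxisymMinimalDatum := by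
  intro ν hν u₀ g hmin hax
  obtain ⟨hL3, hrep, hdiv, -, hnot⟩ := hmin
  exact hnot (h ν hν u₀ g hL3 hrep hdiv (fun θ x => hax θ x))

/-- Re-glue: W0 in place of AKG decides the summit (same logic as the route's `closes`). -/
theorem navierStokesRegularity_of_noAxisymMinimalDatum' (h₂ : MinimalDatumPFold)
    (h₄ : PFoldToAxisymmetric) (h₀ : NoAxisymMinimalDatum) : _root_.NavierStokesRegularity := by
  show Literature.NS.NavierStokesExistenceSmoothR3
  intro ν hν u₀ hsm hdiv hdec
  by_contra hno
  obtain ⟨u₁, g, hmin, hax⟩ := h₄ ν hν (h₂ ν hν ⟨u₀, hsm, hdiv, hdec, hno⟩)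
  exact h₀ ν hν u₁ g hmin (fun θ x => hax θ x)

/-- Re-glue with the PROVED crux `PFoldToAxisymmetric` discharged:
`MinimalDatumPFold → W0 → NavierStokesRegularity`. -/
theorem navierStokesRegularity_of_noAxisymMinimalDatum (h₂ : MinimalDatumPFold)
    (h₀ : NoAxisymMinimalDatum) : _root_.NavierStokesRegularity :=
  navierStokesRegularity_of_noAxisymMinimalDatum' h₂
    Summit.NavierStokesRegularity.NavierStokesRegularity.Theorems.axisymmetricExtremality_pFoldToAxisymmetric_proof
    h₀

/-- W0 ↔ W2 over the tree: swirl-free axisymmetric `L³` data are Kato-global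
(`NoSwirlStratum.axisymmetricKatoGlobal_noSwirl_stratum`, landed), so a swirl-free minimal datum
cannot exist; the "reduce to no swirl" intermediate is W0 again. -/
theorem noAxisymMinimalDatum_iff_noAxisymSwirlMinimalDatum :
    NoAxisymMinimalDatum ↔ NoAxisymSwirlMinimalDatum := by
  constructor
  · intro h ν hν u₀ g hmin hax
    exact absurd hax (h ν hν u₀ g hmin)
  · intro h ν hν u₀ g hmin hax
    have hsw : HasNoSwirl u₀ := h ν hν u₀ g hmin hax
    obtain ⟨hL3, -, hdiv, -, hnot⟩ := hmin
    exact hnot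
      (Summit.NavierStokesRegularity.NavierStokesRegularity.Theorems.AxisymmetricKatoGlobal.NoSwirlStratum.axisymmetricKatoGlobal_noSwirl_stratum
        ν hν u₀ hL3 hdiv (fun θ x => hax θ x) hsw)

/-- Vacuity (re-proved inline; landed as `MinimalDatumPFold.Negative.cruxBody_of_navierStokesRegularity`,
p158786): under the summit the hypothesis of `MinimalDatumPFold` is contradictory. -/
theorem minimalDatumPFold_of_summit (hS : _root_.NavierStokesRegularity) : MinimalDatumPFold := by
  intro ν hν hclay
  obtain ⟨v₀, hsm, hdiv, hdec, hno⟩ := hclay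
  have hS' : Literature.NS.NavierStokesExistenceSmoothR3 := hS
  exact (hno (hS' ν hν v₀ hsm hdiv hdec)).elim

/-- Relative to W0 the route's other open crux is summit-equivalent:
`W0 → (MinimalDatumPFold ↔ NavierStokesRegularity)` (⇐ by the landed vacuity
`MinimalDatumPFold.Negative.cruxBody_of_navierStokesRegularity`). -/
theorem minimalDatumPFold_iff_summit_of_W0 (h₀ : NoAxisymMinimalDatum) :
    MinimalDatumPFold ↔ _root_.NavierStokesRegularity :=
  ⟨fun h₂ => navierStokesRegularity_of_noAxisymMinimalDatum h₂ h₀,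
   fun hS => minimalDatumPFold_of_summit hS⟩

/-- The unconditional bookkeeping identity behind the verdict: the summit is
`MinimalDatumPFold ∧ (W0 ∨ NavierStokesRegularity)`. -/
theorem summit_iff_minimalDatumPFold_and_W0_or :
    _root_.NavierStokesRegularity ↔ (MinimalDatumPFold ∧ (NoAxisymMinimalDatum ∨ _root_.NavierStokesRegularity)) := by
  constructor
  · intro hS
    exact ⟨minimalDatumPFold_of_summit hS, Or.inr hS⟩
  · rintro ⟨h₂, h₀ | hS⟩
    · exact navierStokesRegularity_of_noAxisymMinimalDatum h₂ h₀
    · exact hS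

end Summit.NavierStokesRegularity.NavierStokesRegularity.Cruxes.AxisymmetricKatoGlobal.StrategistS20g14

end
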